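import Summits.AtomisticToContinuum.Crystallization.Theorems.CoarseGrains.Negative.RadiusVacuity

/-!
# `CoarseGrains` / Negative: the radius quantifier is vacuous up to `R ≤ 7/10` (octahedral hole)

Negative knowledge for crux `stmt-AtomisticToContinuum-9331` (`ExcessDecayLiouville.CoarseGrains`),
standing crux-disprover seat `refuter-cdisprove-stmt-AtomisticToContinuum-9331-g2-0` (cycle 2,
2026-08-16); builds on `Negative.PredicateAPI`, `Negative.RadiusVacuity`.  Nothing here closes an
item; no theorem concludes a Theses decl.

The matrix `∃ c t A, Adm A ∧ Inner t A ∧ Near X c R t A (1/40)` of the crux holds for EVERY bounded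
`X` exactly when some admissible datum has a closed `R`-ball free of sites, i.e. iff `R` is below the
supremum of the covering radii of admissible site sets (`≈ 0.70–0.72`: octahedral holes of dilated /
`Inner`-shifted two-lattices).  This file gives the lower bracket; the companion
`Negative.CoveringRadius` gives the upper bracket `4/5`.
* `near_trivial_of_le` / `coarseGrains_matrix_of_le`: for `R ≤ 7/10` the matrix holds for every
  bounded `X` — datum `(199/200)·id` (admissible with equality `‖A − 0.97·id‖ = 1/40`), exact inner
  displacement, ball centred at the image of the octahedral hole `c₀ = −w + ½√(2/3)e₃`, which is
  `≥ (199/200)/√2 ≈ 0.7036 > 7/10` from every site (`half_le_norm_sq_lam_sub_oct`,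
  `half_le_norm_sq_off_lam_sub_oct`, from the integer quadratic forms `int_quad_nonneg₁/₂`).
  Sharpens `RadiusVacuity.near_trivial_of_lt` (`R < 97/200`, bond midpoint of `0.97·id`); provers may
  take `N₀ := 0` for `R ≤ 7/10`.
-/

noncomputable section

open Literature.MathematicalPhysics.StatisticalMechanics

namespace Summit.AtomisticToContinuum.Crystallization.Theorems.CoarseGrains.Negative.VacuityThreshold

open Summit.AtomisticToContinuum.Crystallization.Theorems.CoarseGrains.Negative.PredicateAPI
open Summit.AtomisticToContinuum.Crystallization.Theorems.CoarseGrains.Negative.RadiusVacuity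

/-! ### Integer quadratic forms: in-plane squared distances from the octahedral hole -/

/-- `i² + ij + j² + i + j ≥ 0` on `ℤ²` (`4·lhs = (2i+j+1)² + (3j−1)(j+1)`). [folklore] -/
theorem int_quad_nonneg₁ (i j : ℤ) : 0 ≤ i * i + i * j + j * j + i + j := by
  rcases lt_trichotomy j 0 with hj | hj | hj
  · nlinarith [sq_nonneg (2 * i + j + 1),
      mul_nonneg (by omega : (0 : ℤ) ≤ -(3 * j - 1)) (by omega : (0 : ℤ) ≤ -(j + 1))]
  · subst hj
    rcases le_or_gt 0 i with hi | hi
    · nlinarith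
    · nlinarith [mul_nonneg (by omega : (0 : ℤ) ≤ -i) (by omega : (0 : ℤ) ≤ -(i + 1))]
  · nlinarith [sq_nonneg (2 * i + j + 1),
      mul_nonneg (by omega : (0 : ℤ) ≤ 3 * j - 1) (by omega : (0 : ℤ) ≤ j + 1)]

/-- `i² + ij + j² + 2i + 2j + 1 ≥ 0` on `ℤ²` (`4·lhs = (2i+j+2)² + j(3j+4)`). [folklore] -/
theorem int_quad_nonneg₂ (i j : ℤ) : 0 ≤ i * i + i * j + j * j + 2 * i + 2 * j + 1 := by
  rcases lt_trichotomy j (-1) with hj | hj | hj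
  · nlinarith [sq_nonneg (2 * i + j + 2),
      mul_nonneg (by omega : (0 : ℤ) ≤ -j) (by omega : (0 : ℤ) ≤ -(3 * j + 4))]
  · subst hj
    rcases le_or_gt 0 i with hi | hi
    · nlinarith
    · nlinarith [mul_nonneg (by omega : (0 : ℤ) ≤ -i) (by omega : (0 : ℤ) ≤ -(i + 1))]
  · nlinarith [sq_nonneg (2 * i + j + 2),
      mul_nonneg (by omega : (0 : ℤ) ≤ j) (by omega : (0 : ℤ) ≤ 3 * j + 4)]

/-- Real form of `int_quad_nonneg₁`. -/
theorem real_quad_nonneg₁ (i j : ℤ) : (0 : ℝ) ≤ (i : ℝ) * i + i * j + j * j + i + j := by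
  exact_mod_cast int_quad_nonneg₁ i j

/-- Real form of `int_quad_nonneg₂`. -/
theorem real_quad_nonneg₂ (i j : ℤ) : (0 : ℝ) ≤ (i : ℝ) * i + i * j + j * j + 2 * i + 2 * j + 1 := by
  exact_mod_cast int_quad_nonneg₂ i j

/-- `(4k − 1)² ≥ 1` for `k ∈ ℤ`. [folklore] -/
theorem one_le_sq_four_mul_sub_one (k : ℤ) : (1 : ℝ) ≤ (4 * (k : ℝ) - 1) ^ 2 := by
  have h : (1 : ℤ) ≤ (4 * k - 1) ^ 2 := by
    rcases le_or_gt k 0 with hk | hk <;> nlinarith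
  exact_mod_cast h

/-- `(4k + 1)² ≥ 1` for `k ∈ ℤ`. [folklore] -/
theorem one_le_sq_four_mul_add_one (k : ℤ) : (1 : ℝ) ≤ (4 * (k : ℝ) + 1) ^ 2 := by
  have h : (1 : ℤ) ≤ (4 * k + 1) ^ 2 := by
    rcases le_or_gt 0 k with hk | hk <;> nlinarith
  exact_mod_cast h

/-! ### The octahedral hole `c₀ = −w + ½√(2/3)e₃` is `≥ 1/√2` from every site of the unit hcp two-lattice -/

/-- Coordinates of the octahedral hole `c₀ = −w + ½√(2/3)e₃ = (−1/2, −√3/6, √(2/3)/2)`. [folklore] -/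
theorem octCentre_apply :
    (-barlowOffset 1 + layerNormal (Real.sqrt (2 / 3) / 2) : E3) 0 = -(1 / 2) ∧
    (-barlowOffset 1 + layerNormal (Real.sqrt (2 / 3) / 2) : E3) 1 = -(Real.sqrt 3 / 6) ∧
    (-barlowOffset 1 + layerNormal (Real.sqrt (2 / 3) / 2) : E3) 2 = Real.sqrt (2 / 3) / 2 := by
  refine ⟨?_, ?_, ?_⟩ <;> simp [barlowOffset, layerNormal]

/-- `‖c₀‖ ≤ 1` (indeed `‖c₀‖² = 1/2`). [folklore] -/
theorem norm_octCentre_le_one : ‖(-barlowOffset 1 + layerNormal (Real.sqrt (2 / 3) / 2) : E3)‖ ≤ 1 := by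
  obtain ⟨c0, c1, c2⟩ := octCentre_apply
  set oct : E3 := -barlowOffset 1 + layerNormal (Real.sqrt (2 / 3) / 2) with hoct
  have hn : ‖oct‖ ^ 2 = oct 0 ^ 2 + oct 1 ^ 2 + oct 2 ^ 2 := by
    rw [EuclideanSpace.norm_eq, Real.sq_sqrt (by positivity), Fin.sum_univ_three]
    simp [Real.norm_eq_abs, sq_abs]
  have hsq : ‖oct‖ ^ 2 ≤ 1 := by
    rw [hn, c0, c1, c2]
    nlinarith [Real.sq_sqrt (show (0 : ℝ) ≤ 3 by norm_num), sqrt23_sq,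
      Real.sqrt_nonneg (3 : ℝ), Real.sqrt_nonneg (2 / 3 : ℝ)]
  nlinarith [norm_nonneg oct]

/-- Sublattice 0: `‖z − c₀‖² ≥ 1/2` for `z ∈ Λ` (in-plane part `i² + ij + j² + i + j + 1/3 ≥ 1/3`,
height part `(4k − 1)²/6 ≥ 1/6`). [folklore] -/
theorem half_le_norm_sq_lam_sub_oct (i j k : ℤ) :
    (1 : ℝ) / 2 ≤ ‖((i : ℝ) • triangularVec₁ 1 + (j : ℝ) • triangularVec₂ 1 +
      (k : ℝ) • layerNormal (2 * Real.sqrt (2 / 3)) : E3) -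
      (-barlowOffset 1 + layerNormal (Real.sqrt (2 / 3) / 2))‖ ^ 2 := by
  obtain ⟨c0, c1, c2⟩ := octCentre_apply
  set oct : E3 := -barlowOffset 1 + layerNormal (Real.sqrt (2 / 3) / 2) with hoct
  set zz : E3 := (i : ℝ) • triangularVec₁ 1 + (j : ℝ) • triangularVec₂ 1 +
      (k : ℝ) • layerNormal (2 * Real.sqrt (2 / 3)) with hzz
  obtain ⟨h0, h1, h2⟩ := lamVec_apply (i : ℝ) j k
  have e0 : (zz - oct) 0 = (i : ℝ) + j / 2 + 1 / 2 := by rw [PiLp.sub_apply, h0, c0]; ring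
  have e1 : (zz - oct) 1 = Real.sqrt 3 * ((j : ℝ) / 2 + 1 / 6) := by
    rw [PiLp.sub_apply, h1, c1]; ring
  have e2 : (zz - oct) 2 = Real.sqrt (2 / 3) * (2 * (k : ℝ) - 1 / 2) := by
    rw [PiLp.sub_apply, h2, c2]; ring
  have hn : ‖zz - oct‖ ^ 2 = (zz - oct) 0 ^ 2 + (zz - oct) 1 ^ 2 + (zz - oct) 2 ^ 2 := by
    rw [EuclideanSpace.norm_eq, Real.sq_sqrt (by positivity), Fin.sum_univ_three]
    simp [Real.norm_eq_abs, sq_abs]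
  rw [hn, e0, e1, e2, mul_pow, mul_pow, Real.sq_sqrt (show (0 : ℝ) ≤ 3 by norm_num), sqrt23_sq]
  have hq := real_quad_nonneg₁ i j
  have hk := one_le_sq_four_mul_sub_one k
  nlinarith [hq, hk]

/-- Sublattice 1: `‖(w + √(2/3)e₃) + z − c₀‖² ≥ 1/2` for `z ∈ Λ` (in-plane part
`i² + ij + j² + 2i + 2j + 4/3 ≥ 1/3`, height part `(4k + 1)²/6 ≥ 1/6`). [folklore] -/
theorem half_le_norm_sq_off_lam_sub_oct (i j k : ℤ) :
    (1 : ℝ) / 2 ≤ ‖(barlowOffset 1 + layerNormal (Real.sqrt (2 / 3))) +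
      ((i : ℝ) • triangularVec₁ 1 + (j : ℝ) • triangularVec₂ 1 +
      (k : ℝ) • layerNormal (2 * Real.sqrt (2 / 3)) : E3) -
      (-barlowOffset 1 + layerNormal (Real.sqrt (2 / 3) / 2))‖ ^ 2 := by
  obtain ⟨c0, c1, c2⟩ := octCentre_apply
  set oct : E3 := -barlowOffset 1 + layerNormal (Real.sqrt (2 / 3) / 2) with hoct
  set off : E3 := barlowOffset 1 + layerNormal (Real.sqrt (2 / 3)) with hoff
  set zz : E3 := (i : ℝ) • triangularVec₁ 1 + (j : ℝ) • triangularVec₂ 1 +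
      (k : ℝ) • layerNormal (2 * Real.sqrt (2 / 3)) with hzz
  obtain ⟨h0, h1, h2⟩ := lamVec_apply (i : ℝ) j k
  have o0 : off 0 = 1 / 2 := by simp [hoff, barlowOffset, layerNormal]
  have o1 : off 1 = Real.sqrt 3 / 6 := by simp [hoff, barlowOffset, layerNormal]
  have o2 : off 2 = Real.sqrt (2 / 3) := by simp [hoff, barlowOffset, layerNormal]
  have e0 : (off + zz - oct) 0 = (i : ℝ) + j / 2 + 1 := by
    rw [PiLp.sub_apply, PiLp.add_apply, h0, c0, o0]; ring
  have e1 : (off + zz - oct) 1 = Real.sqrt 3 * ((j : ℝ) / 2 + 1 / 3) := by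
    rw [PiLp.sub_apply, PiLp.add_apply, h1, c1, o1]; ring
  have e2 : (off + zz - oct) 2 = Real.sqrt (2 / 3) * (2 * (k : ℝ) + 1 / 2) := by
    rw [PiLp.sub_apply, PiLp.add_apply, h2, c2, o2]; ring
  have hn : ‖off + zz - oct‖ ^ 2 =
      (off + zz - oct) 0 ^ 2 + (off + zz - oct) 1 ^ 2 + (off + zz - oct) 2 ^ 2 := by
    rw [EuclideanSpace.norm_eq, Real.sq_sqrt (by positivity), Fin.sum_univ_three]
    simp [Real.norm_eq_abs, sq_abs]
  rw [hn, e0, e1, e2, mul_pow, mul_pow, Real.sq_sqrt (show (0 : ℝ) ≤ 3 by norm_num), sqrt23_sq]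
  have hq := real_quad_nonneg₂ i j
  have hk := one_le_sq_four_mul_add_one k
  nlinarith [hq, hk]

/-! ### Vacuity up to `R ≤ 7/10`: the maximally dilated isotropic datum `A = (199/200)·id` -/

/-- For `R ≤ 7/10` the conclusion of `CoarseGrains` holds for EVERY bounded `X`: take the isotropic
datum `A = (199/200)·id` (admissible with equality: `‖A − 0.97·id‖ = 1/40`), exact inner displacement,
origin parked farther than `R` from `X`, and centre the ball at the image of the octahedral hole
`c₀ = −w + ½√(2/3)e₃`; every site is `≥ (199/200)/√2 ≈ 0.7036 > 7/10` from the centre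
(`half_le_norm_sq_lam_sub_oct`, `half_le_norm_sq_off_lam_sub_oct`), so both matching clauses are
vacuous.  Sharpens `RadiusVacuity.near_trivial_of_lt` (`R < 97/200`, bond midpoint of `0.97·id`).
[folklore] -/
theorem near_trivial_of_le {R : ℝ} (hR : R ≤ 7 / 10) {X : Set E3} (hX : Bornology.IsBounded X) :
    ∃ (c : E3) (t : Fin 2 → E3) (A : E3 →L[ℝ] E3), Adm A ∧ Inner t A ∧ Near X c R t A (1 / 40) := by
  obtain ⟨M, hMpos, hM⟩ := hX.exists_pos_norm_le
  have hoct_norm := norm_octCentre_le_one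
  set oct : E3 := -barlowOffset 1 + layerNormal (Real.sqrt (2 / 3) / 2) with hoct
  set u : E3 := triangularVec₁ 1 with hu
  have hu1 : ‖u‖ = 1 := norm_triangularVec₁
  set s : ℝ := 199 / 200 with hs
  set A : E3 →L[ℝ] E3 := s • ContinuousLinearMap.id ℝ E3 with hAdef
  have hA : ∀ w : E3, A w = s • w := fun w => by simp [hAdef]
  set F : E3 := (M + 2) • u with hF
  set off : E3 := barlowOffset 1 + layerNormal (Real.sqrt (2 / 3)) with hoff
  set t : Fin 2 → E3 := ![F, F + A off] with ht
  set c : E3 := F + A oct with hc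
  have ht0 : t 0 = F := by simp [ht]
  have ht1 : t 1 = F + A off := by simp [ht]
  refine ⟨c, t, A, ?_, ?_, ?_, ?_⟩
  · refine ⟨LinearIsometryEquiv.refl ℝ E3, ?_⟩
    have h0 : A - (97 / 100 : ℝ) •
        ((LinearIsometryEquiv.refl ℝ E3).toContinuousLinearEquiv : E3 →L[ℝ] E3) =
        (1 / 40 : ℝ) • ContinuousLinearMap.id ℝ E3 := by
      ext w
      simp [hAdef, hs]
      ring
    rw [h0, norm_smul, ContinuousLinearMap.norm_id, Real.norm_eq_abs]
    norm_num
  · change ‖t 1 - t 0 - A off‖ ≤ 1 / 40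
    rw [ht1, ht0]; simp
  · intro p hp hpc
    exfalso
    have hcF : ‖c‖ ≥ M + 1 := by
      have h1 : ‖F‖ = M + 2 := by
        rw [hF, norm_smul, hu1, mul_one, Real.norm_eq_abs, abs_of_pos (by linarith)]
      have h2 : ‖A oct‖ ≤ 1 := by
        rw [hA, norm_smul, hs, Real.norm_eq_abs, abs_of_pos (by norm_num)]
        nlinarith [norm_nonneg oct]
      have h3 : ‖F‖ - ‖A oct‖ ≤ ‖c‖ := by
        rw [hc]; exact norm_sub_le_norm_add _ _ |>.trans' (le_refl _)
      linarith
    have h1 : ‖c‖ - ‖p‖ ≤ dist p c := by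
      rw [dist_comm, dist_eq_norm]; exact norm_sub_norm_le c p
    have h2 := hM p hp
    linarith
  · intro m z hz hzc
    exfalso
    obtain ⟨i, j, k, rfl⟩ := hz
    set zz : E3 := (i : ℝ) • triangularVec₁ 1 + (j : ℝ) • triangularVec₂ 1 +
      (k : ℝ) • layerNormal (2 * Real.sqrt (2 / 3)) with hzz
    have hm : m = 0 ∨ m = 1 := by
      rcases m with ⟨_ | _ | n, hn⟩
      · exact Or.inl rfl
      · exact Or.inr rfl
      · omega
    have hR0 : 0 ≤ R := le_trans dist_nonneg hzc
    have hfar : s ^ 2 * (1 / 2) ≤ dist (t m + A zz) c ^ 2 := by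
      rcases hm with hm | hm
      · rw [hm, ht0, hc, dist_eq_norm]
        have e : F + A zz - (F + A oct) = A zz - A oct := by abel
        rw [e, ← map_sub, hA, norm_smul, hs, Real.norm_eq_abs, abs_of_pos (by norm_num), mul_pow]
        exact mul_le_mul_of_nonneg_left (half_le_norm_sq_lam_sub_oct i j k) (by norm_num)
      · rw [hm, ht1, hc, dist_eq_norm]
        have e : F + A off + A zz - (F + A oct) = A off + A zz - A oct := by abel
        rw [e, ← map_add, ← map_sub, hA, norm_smul, hs, Real.norm_eq_abs, abs_of_pos (by norm_num),
          mul_pow]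
        exact mul_le_mul_of_nonneg_left (half_le_norm_sq_off_lam_sub_oct i j k) (by norm_num)
    have hd2 : dist (t m + A zz) c ^ 2 ≤ R ^ 2 := pow_le_pow_left₀ dist_nonneg hzc 2
    have hR2 : R ^ 2 ≤ (7 / 10) ^ 2 := pow_le_pow_left₀ hR0 hR 2
    rw [hs] at hfar
    nlinarith

/-- Corollary: the matrix of `CoarseGrains` at every radius `R ≤ 7/10` holds for every finite
configuration (provers may take `N₀ := 0` there). [folklore] -/
theorem coarseGrains_matrix_of_le {R : ℝ} (hR : R ≤ 7 / 10) {N : ℕ} (x : Fin N → E3) :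
    ∃ (c : E3) (t : Fin 2 → E3) (A : E3 →L[ℝ] E3), Adm A ∧ Inner t A ∧
      Near (Set.range x) c R t A (1 / 40) :=
  near_trivial_of_le hR (Set.finite_range x).isBounded


end Summit.AtomisticToContinuum.Crystallization.Theorems.CoarseGrains.Negative.VacuityThreshold

end
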